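import Literature.Computability.AlgebraicComplexity.RealTauConjectureProofs
import Literature.Computability.AlgebraicComplexity.DepthReductionProofs
import Literature.Computability.AlgebraicComplexity.ConstantFreeCircuits
import HarnessLib

/-!
# Tavenas' Proposition 3.21 from Proposition 3.17 and the depth-four reduction

Companion file of `Literature.Computability.AlgebraicComplexity.RealTauConjectureProofs`
(Koiran–Tavenas transfer theorem, Tavenas 2014 Thm. 3.3). It decomposes the named fact
`Tavenas2014_prop_3_21` (Prop. 3.21, case `c = 1`, over `ℚ`) along its printed two-line proof
(thesis p. 47: "D'après la proposition 3.17 … D'après le théorème 2.16 …"):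

* **Proposition 3.17** (case `c = 1`, over `K = ℚ`) is vendored as the named fact
  `Tavenas2014_prop_3_17` (D-0014): for a family `(f_n) ⊂ ℤ[X]` definable in `P/poly` with
  `deg f_n < 2^d` and coefficients `< 2^{2^r}`, `d, r = n^{O(1)}`, there is a p-bounded `q` such
  that `f_n(X) = h_n(X^{2^0}, …, X^{2^{d-1}}, 2^{2^0}, …, 2^{2^{r-1}})` (display (3.1)) for a
  multilinear `h_n` that is a projection of `PER_{q(n)}`. Its proof is Valiant's criterion
  (Prop. 3.10, `GapP/poly` form) and the `VNP`-completeness of the permanent (Thm. 1.26),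
  neither of which is formalised.
* **Theorem 2.16** (Tavenas' depth-four reduction with the Agrawal–Vinay/Koiran bounds) is the
  tree's PROVED structural theorem `Literature.Computability.AlgebraicComplexity.DepthReduction.SLP.exists_sum_prod`
  (`GateQuotients.lean`): a value of degree `≤ δ` of a straight-line program of length `s` is a
  sum of `≤ (δ+1)(16 s²(δ+1)⁴)^{8δ/(t+1)}` products of `≤ 1 + 32δ/(t+1)` polynomials of degree
  `≤ t`.
* PROVED here: `Tavenas2014_prop_3_21_of_prop_3_17`, the printed derivation of Prop. 3.21:
  under `τ(PER_n) = n^{O(1)}`, `L_ℚ(h_n) ≤ L_ℚ(PER_{q(n)}) ≤ τ(PER_{q(n)}) = n^{O(1)}`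
  (projections are free, `IsProjection.complexity_le_holds`; a constant-free circuit over `ℤ` is a
  circuit over `ℚ`, `complexity_map_le_constantFreeComplexity` via the discharge
  `ArithCircuit.eval_map_holds` of the named fact `ArithCircuit.eval_map`); `h_n` is multilinear in
  `d + r ≤ 2d` variables, so of degree `δ ≤ 2d`; the depth reduction with `t = ⌊√δ⌋ + 1` writes
  `h_n` as `∑_{i ≤ k} ∏_{j ≤ m} p_{ij}` with `k ≤ (n+2)^{O(√d)}`, `m = O(√d)` and
  `deg p_{ij} ≤ t`, hence `p_{ij}` has `≤ (t+1)(δ+t)^t = (n+2)^{O(√d)}` monomials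
  (`DepthReduction.card_le_of_degree_le`); the substitution (3.1) maps monomials to monomials
  (`card_support_aeval_le_of_isTerm`), so `f_n = ∑ ∏ p_{ij}(X^{2^•}, 2^{2^•})` is the required
  expression with `(n+2)^{O(√d)}`-sparse factors. The `O`-constants are tracked explicitly
  (`prop321Const`).

## References

* S. Tavenas, *Bornes inférieures et supérieures dans les circuits arithmétiques*, PhD thesis,
  ENS Lyon 2014, Prop. 3.10, Prop. 3.17 and its proof (display (3.1)), Cor. 3.18, Prop. 3.21 and
  its proof (pp. 45–47); Thm. 2.16, Prop. 2.18.
* P. Koiran, *Shallow circuits with high-powered inputs*, ICS 2011, Lemma 3, Thm. 6–7, Prop. 2.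
* S. Tavenas, *Improved bounds for reduction to depth 4 and depth 3*, Inform. and Comput. 240
  (2015) 2–11, Thm. 1; M. Agrawal, V. Vinay, FOCS 2008.
* P. Bürgisser, *Completeness and Reduction in Algebraic Complexity Theory*, Springer 2000,
  Def. 2.1, Rem. 2.7 (projections do not increase complexity), §4.1 (change of coefficients).
-/

noncomputable section

open MvPolynomial

universe u v w

/-! ### Circuits under a change of coefficients (discharge of `ArithCircuit.eval_map`) -/

namespace Literature.Computability.AlgebraicComplexity.ArithCircuit

variable {k : Type u} {k' : Type w} {σ : Type v}

/-- A change of coefficients does not change the size. [cite: Burgisser2000, §4.1] -/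
@[simp] theorem size_map [CommSemiring k] [CommSemiring k'] (φ : k →+* k') (P : ArithCircuit k σ) :
    (P.map φ).size = P.size := by
  simp [ArithCircuit.map, size]

/-- A change of coefficients does not change the fan-in of a gate. [cite: Burgisser2000, §4.1] -/
theorem Gate.fanIn_map (φ : k → k') (g : Gate k σ) : (g.map φ).fanIn = g.fanIn := by
  cases g <;> simp [Gate.map, Gate.fanIn, Gate.args]

/-- A change of coefficients preserves fan-in two. [cite: Burgisser2000, §4.1] -/
theorem IsFanInTwo.map [CommSemiring k] [CommSemiring k'] {P : ArithCircuit k σ} (hP : P.IsFanInTwo)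
    (φ : k →+* k') : (P.map φ).IsFanInTwo := by
  intro g hg
  simp only [ArithCircuit.map, List.mem_map] at hg
  obtain ⟨g', hg', rfl⟩ := hg
  rw [Gate.fanIn_map]
  exact hP g' hg'

variable [CommSemiring k] [CommSemiring k']

/-- A mapped operand, read against the mapped value list, evaluates to the mapped value. [cite: Burgisser2000, §4.1] -/
theorem Operand.eval_map (φ : k →+* k') (vals : List (MvPolynomial σ k)) (u : Operand k σ) :
    (u.map φ).eval (vals.map (MvPolynomial.map φ)) = MvPolynomial.map φ (u.eval vals) := by
  cases u with
  | var i => simp [Operand.map, Operand.eval]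
  | const c => simp [Operand.map, Operand.eval]
  | gate j =>
    simp only [Operand.map, Operand.eval, List.getD_eq_getElem?_getD, List.getElem?_map]
    cases vals[j]? <;> simp

/-- A mapped gate, read against the mapped value list, evaluates to the mapped value (`map φ` is a
ring homomorphism commuting with `C`). [cite: Burgisser2000, §4.1] -/
theorem Gate.eval_map (φ : k →+* k') (vals : List (MvPolynomial σ k)) (g : Gate k σ) :
    (g.map φ).eval (vals.map (MvPolynomial.map φ)) = MvPolynomial.map φ (g.eval vals) := by
  cases g with
  | sum args =>
    simp only [Gate.map, Gate.eval, List.map_map, map_list_sum]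
    congr 1
    simp [Function.comp_def, Operand.eval_map, MvPolynomial.smul_eq_C_mul, map_C]
  | prod args =>
    simp only [Gate.map, Gate.eval, List.map_map, map_list_prod]
    congr 1
    simp [Function.comp_def, Operand.eval_map]

/-- The value list of a mapped gate list is the mapped value list. [cite: Burgisser2000, §4.1] -/
theorem gateValues_map (φ : k →+* k') (gs : List (Gate k σ)) :
    gateValues (gs.map (Gate.map φ)) = (gateValues gs).map (MvPolynomial.map φ) := by
  induction gs using List.reverseRecOn with
  | nil => rfl
  | append_singleton gs g ih =>
    rw [List.map_append, List.map_singleton, gateValues_append_singleton,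
      gateValues_append_singleton, ih, Gate.eval_map, List.map_append, List.map_singleton]

/-- Change of coefficients maps the computed polynomial, pointwise form. [cite: Burgisser2000, §4.1] -/
theorem eval_map_apply (φ : k →+* k') (P : ArithCircuit k σ) :
    (P.map φ).eval = MvPolynomial.map φ P.eval := by
  change (P.output.map φ).eval (gateValues (P.gates.map (Gate.map φ))) = _
  rw [gateValues_map, Operand.eval_map]
  rfl

/-- **Discharge of the named fact `ArithCircuit.eval_map`** (Bürgisser 2000, §4.1). [cite: Burgisser2000, §4.1] -/
theorem eval_map_holds : eval_map (k := k) (σ := σ) :=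
  fun φ P => eval_map_apply φ P

/-- If `P` computes `f` then `P.map φ` computes `map φ f`. [cite: Burgisser2000, §4.1] -/
theorem Computes.map {P : ArithCircuit k σ} {f : MvPolynomial σ k} (h : P.Computes f) (φ : k →+* k') :
    (P.map φ).Computes (MvPolynomial.map φ f) := by
  unfold Computes at h ⊢
  rw [eval_map_apply, h]

/-- **A constant-free circuit over `ℤ` is a circuit over any commutative semiring**:
`L_{k'}(φ f) ≤ τ(f)` for the canonical map `φ : ℤ → k'` (indeed for any ring homomorphism).
[cite: Burgisser2000, §4.1] -/
theorem complexity_map_le_constantFreeComplexity (φ : ℤ →+* k') (f : MvPolynomial σ ℤ) :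
    complexity (MvPolynomial.map φ f) ≤ constantFreeComplexity f := by
  obtain ⟨P, h1, -, h3, h4⟩ := exists_computes_size_eq_constantFreeComplexity f
  rw [← h4, ← size_map φ P]
  exact complexity_le_size (h1.map φ) (h3.map φ)

end Literature.Computability.AlgebraicComplexity.ArithCircuit

namespace Literature.Computability.AlgebraicComplexity

open ArithCircuit Complexity

/-! ### Projections are free (discharge of `IsProjection.complexity_le`) -/

section Projection

variable {k : Type u} [CommSemiring k] {σ : Type v} {τ : Type w}

/-- **Discharge of `IsProjection.complexity_le`**: substituting variables and constants into the
inputs of a minimal circuit costs nothing (`substCircuit` with empty prefix; Bürgisser 2000,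
Rem. 2.7). [cite: Burgisser2000, Rem. 2.7] -/
theorem IsProjection.complexity_le_holds : IsProjection.complexity_le (k := k) (σ := σ) (τ := τ) := by
  classical
  intro g f h
  obtain ⟨a, ha, rfl⟩ := h
  obtain ⟨P, hP1, hP2, hP3⟩ := exists_computes_size_eq_complexity f
  let ρ : σ → Operand k τ := fun i =>
    if hx : ∃ j, a i = X j then .var hx.choose else .const ((ha i).resolve_left hx).choose
  have hρ : ∀ i ws, (ρ i).eval (gateValues ([] : List (Gate k τ)) ++ ws) = a i := by
    intro i ws
    by_cases hx : ∃ j, a i = X j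
    · simp only [ρ, dif_pos hx, Operand.eval]
      exact hx.choose_spec.symm
    · simp only [ρ, dif_neg hx, Operand.eval]
      exact ((ha i).resolve_left hx).choose_spec.symm
  have hcomp : (P.substCircuit [] ρ).Computes (aeval a f) := by
    rw [Computes] at hP2 ⊢
    rw [eval_substCircuit P [] hρ, hP2]
  calc complexity (aeval a f) ≤ (P.substCircuit [] ρ).size :=
        complexity_le_size (hP1.substCircuit (by simp) ρ) hcomp
    _ = complexity f := by rw [size_substCircuit, List.length_nil, zero_add, hP3]

end Projection

/-! ### Terms `c X^e` and sparsity under monomial substitutions -/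

section Terms

open Polynomial

variable {R : Type u} [CommSemiring R] {σ : Type v}

/-- A univariate polynomial is a *term* if it is `C c * X ^ e`. [folklore] -/
def IsTerm (p : Polynomial R) : Prop :=
  ∃ (c : R) (e : ℕ), p = Polynomial.C c * Polynomial.X ^ e

/-- Constants are terms. [folklore] -/
theorem isTerm_C (c : R) : IsTerm (Polynomial.C c) := ⟨c, 0, by simp⟩

/-- `1` is a term. [folklore] -/
theorem isTerm_one : IsTerm (1 : Polynomial R) := ⟨1, 0, by simp⟩

/-- Powers of `X` are terms. [folklore] -/
theorem isTerm_X_pow (e : ℕ) : IsTerm ((Polynomial.X : Polynomial R) ^ e) := ⟨1, e, by simp⟩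

/-- Terms are closed under products. [folklore] -/
theorem IsTerm.mul {p q : Polynomial R} (hp : IsTerm p) (hq : IsTerm q) : IsTerm (p * q) := by
  obtain ⟨c, e, rfl⟩ := hp
  obtain ⟨c', e', rfl⟩ := hq
  refine ⟨c * c', e + e', ?_⟩
  rw [Polynomial.C_mul, pow_add]; ring

/-- Terms are closed under powers. [folklore] -/
theorem IsTerm.pow {p : Polynomial R} (hp : IsTerm p) (n : ℕ) : IsTerm (p ^ n) := by
  induction n with
  | zero => rw [pow_zero]; exact isTerm_one
  | succ n ih => rw [pow_succ]; exact ih.mul hp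

/-- Terms are closed under finite products. [folklore] -/
theorem IsTerm.finset_prod {ι : Type*} (s : Finset ι) (f : ι → Polynomial R) (h : ∀ i ∈ s, IsTerm (f i)) :
    IsTerm (∏ i ∈ s, f i) := by
  classical
  induction s using Finset.induction_on with
  | empty => rw [Finset.prod_empty]; exact isTerm_one
  | insert a s ha ih =>
    rw [Finset.prod_insert ha]
    exact (h a (Finset.mem_insert_self a s)).mul (ih fun i hi => h i (Finset.mem_insert_of_mem hi))

/-- A term has at most one monomial. [folklore] -/
theorem IsTerm.card_support_le {p : Polynomial R} (hp : IsTerm p) : p.support.card ≤ 1 := by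
  obtain ⟨c, e, rfl⟩ := hp
  exact Polynomial.card_support_C_mul_X_pow_le_one

/-- A substitution of terms for the variables maps monomials to terms. [folklore] -/
theorem isTerm_aeval_monomial {v : σ → Polynomial R} (hv : ∀ x, IsTerm (v x)) (m : σ →₀ ℕ) (c : R) :
    IsTerm (MvPolynomial.aeval v (MvPolynomial.monomial m c)) := by
  rw [MvPolynomial.aeval_monomial, Finsupp.prod]
  refine IsTerm.mul ?_ (IsTerm.finset_prod _ _ fun x _ => (hv x).pow _)
  rw [Polynomial.algebraMap_eq]
  exact isTerm_C c

/-- **Monomial substitutions do not increase the number of monomials**: if every `v x` is a term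
then `aeval v p` has at most as many monomials as `p`. [cite: Tavenas2014, proof of Prop. 3.21] -/
theorem card_support_aeval_le_of_isTerm {v : σ → Polynomial R} (hv : ∀ x, IsTerm (v x))
    (p : MvPolynomial σ R) : (MvPolynomial.aeval v p).support.card ≤ p.support.card := by
  classical
  have key : ∀ s : Finset (σ →₀ ℕ),
      (MvPolynomial.aeval v (∑ m ∈ s, MvPolynomial.monomial m (p.coeff m))).support.card ≤ s.card := by
    intro s
    induction s using Finset.induction_on with
    | empty => simp
    | insert a s ha ih =>
      rw [Finset.sum_insert ha, map_add, Finset.card_insert_of_notMem ha]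
      calc (MvPolynomial.aeval v (MvPolynomial.monomial a (p.coeff a)) +
              MvPolynomial.aeval v (∑ m ∈ s, MvPolynomial.monomial m (p.coeff m))).support.card
          ≤ ((MvPolynomial.aeval v (MvPolynomial.monomial a (p.coeff a))).support ∪
              (MvPolynomial.aeval v (∑ m ∈ s, MvPolynomial.monomial m (p.coeff m))).support).card :=
            Finset.card_le_card Polynomial.support_add
        _ ≤ (MvPolynomial.aeval v (MvPolynomial.monomial a (p.coeff a))).support.card +
              (MvPolynomial.aeval v (∑ m ∈ s, MvPolynomial.monomial m (p.coeff m))).support.card :=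
            Finset.card_union_le _ _
        _ ≤ 1 + s.card := Nat.add_le_add (isTerm_aeval_monomial hv a _).card_support_le ih
        _ = s.card + 1 := Nat.add_comm _ _
  conv_lhs => rw [p.as_sum]
  exact key p.support

end Terms

/-! ### Multilinear polynomials have small degree -/

/-- A multilinear polynomial has total degree at most the number of variables. [folklore] -/
theorem totalDegree_le_card_of_multilinear {R : Type u} [CommSemiring R] {σ : Type v} [Fintype σ]
    {p : MvPolynomial σ R} (h : ∀ m ∈ p.support, ∀ x, m x ≤ 1) : p.totalDegree ≤ Fintype.card σ := by
  rw [MvPolynomial.totalDegree]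
  refine Finset.sup_le fun m hm => ?_
  calc (m.sum fun _ e => e) = ∑ x ∈ m.support, m x := rfl
    _ ≤ ∑ x ∈ m.support, 1 := Finset.sum_le_sum fun x _ => h m hm x
    _ = m.support.card := by simp
    _ ≤ Fintype.card σ := Finset.card_le_univ _

/-! ### Proposition 3.17 (named fact) -/

open Polynomial in
/-- The substitution of display (3.1) of Tavenas' thesis (proof of Prop. 3.17), case `c = 1`:
`x_j ↦ X^{2^j}` (`j < d`) and `z_i ↦ 2^{2^i}` (`i < r`). [cite: Tavenas2014, proof of Prop. 3.17, (3.1)] -/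
def kpSubst (d r : ℕ) : Fin d ⊕ Fin r → Polynomial ℚ :=
  Sum.elim (fun j => Polynomial.X ^ 2 ^ (j : ℕ)) (fun i => Polynomial.C ((2 : ℚ) ^ 2 ^ (i : ℕ)))

/-- Every value of the substitution (3.1) is a term `c X^e`. [folklore] -/
theorem isTerm_kpSubst (d r : ℕ) (x : Fin d ⊕ Fin r) : IsTerm (kpSubst d r x) := by
  cases x with
  | inl j => exact isTerm_X_pow _
  | inr i => exact isTerm_C _

/-- **Tavenas' Proposition 3.17**, case `c = 1` (one variable), over `K = ℚ` (thesis 2014,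
Prop. 3.17 with its proof, display (3.1)). Printed statement: let `p` be a polynomial and `(f_n)`
a family of integer polynomials in `ℤ[X_1, …, X_{p(n)}]` definable in `P/poly`, of degree at most
`2^d - 1` in each variable and with coefficients of absolute value at most `2^{2^r} - 1`, where
`r, d = n^{O(1)}`. If `Perm_n` is computed by a family of circuits `C_n`, then there are a
polynomial `q` and a projection `D_n` of the circuit `C_{q(n)}` such that `f_n` is computed by a
circuit `D_n(Y_1, …, Y_k)` where the `Y_i` are powers of the `X_{j_i}` with exponents at most
`2^{d-1}` and `k ≤ d p(n) + r`; moreover `D_n` computes a polynomial homogeneous in the `Y`, and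
`q` depends only on the family `(f_n)`. The proof (p. 46) exhibits the multilinear polynomial
`h_n(x_{1,0}, …, x_{p,d-1}, z_0, …, z_{r-1}) = ∑_{i,α} a_i(n, α) x^{bits of α} z^{bits of i}` with
`f_n(X) = h_n(X_1^{2^0}, …, X_p^{2^{d-1}}, 2^{2^0}, …, 2^{2^{r-1}})` (3.1), shows `(h_n) ∈ VNP⁰`
by Valiant's criterion (Prop. 3.10) and concludes by the `VNP`-completeness of the permanent that
`h_n` is computed by a projection `D_n` of `C_{q(n)}`.
Rendering (`p = c = 1`): the conclusion is stated for the polynomial `h_n` — multilinear, a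
Valiant projection (`IsProjection`) of `PER_{q(n)}` over `ℚ` (so that, for every circuit family
`(C_n)` computing the permanent, the same substitution applied to `C_{q(n)}` is the printed
circuit `D_n`), with `f_n = h_n(X^{2^j}; 2^{2^i})` (`kpSubst`) and `q` p-bounded; the
homogeneity clause is dropped (WEAKER than print); hypotheses as in `Tavenas2014_prop_3_21`
(`IsDefinableSeqIn PPoly`, `deg f_n < 2^{d(n)}`, `|coeff| < 2^{2^{r(n)}}`, `d, r` p-bounded).
Named fact (D-0014): Valiant's criterion in the `GapP/poly` form and the `VNP`-completeness of
`PER` over `ℚ` are not formalised. [cite: Tavenas2014, Prop. 3.17] -/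
def Tavenas2014_prop_3_17 : Prop :=
  ∀ (f : ℕ → Polynomial ℤ) (d r : ℕ → ℕ), IsPBounded d → IsPBounded r →
    IsDefinableSeqIn PPoly f →
    (∀ n, (f n).natDegree < 2 ^ d n) →
    (∀ n α, ((f n).coeff α).natAbs < 2 ^ 2 ^ r n) →
    ∃ q : ℕ → ℕ, IsPBounded q ∧ ∀ n,
      ∃ h : MvPolynomial (Fin (d n) ⊕ Fin (r n)) ℚ,
        IsProjection h (perPoly (Fin (q n)) ℚ) ∧
        (∀ m ∈ h.support, ∀ x, m x ≤ 1) ∧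
        MvPolynomial.aeval (kpSubst (d n) (r n)) h = (f n).map (Int.castRingHom ℚ)

/-! ### Arithmetic of the `O`-constants -/

/-- A p-bounded function is at most `(n + 2)^e` for a constant `e`. [folklore] -/
theorem IsPBounded.exists_le_pow {F : ℕ → ℕ} (hF : IsPBounded F) : ∃ e : ℕ, ∀ n, F n ≤ (n + 2) ^ e := by
  obtain ⟨c, hc⟩ := hF
  refine ⟨c + 1, fun n => ?_⟩
  have h := DepthReduction.le_two_mul_pow (hc n) le_rfl
  calc F n ≤ 2 * (n + 2) ^ c := h
    _ ≤ (n + 2) * (n + 2) ^ c := Nat.mul_le_mul_right _ (by omega)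
    _ = (n + 2) ^ (c + 1) := by rw [pow_succ']

/-- `a · B^e ≤ B^{e + a}` for `B ≥ 2` (crude absorption of constant factors). [folklore] -/
theorem mul_pow_le_pow_add {B a e : ℕ} (hB : 2 ≤ B) : a * B ^ e ≤ B ^ (e + a) := by
  rw [pow_add]
  rw [mul_comm]
  apply Nat.mul_le_mul_left
  calc a ≤ 2 ^ a := Nat.lt_two_pow_self.le
    _ ≤ B ^ a := Nat.pow_le_pow_left hB a

/-- The square-root bookkeeping: with `δ ≤ 2 d` and `u = ⌊√δ⌋ + 1` one has `u ≤ 2 (⌊√d⌋ + 1)`. [folklore] -/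
theorem sqrt_add_one_le {δ d : ℕ} (h : δ ≤ 2 * d) : Nat.sqrt δ + 1 ≤ 2 * (Nat.sqrt d + 1) := by
  have h1 : d < (Nat.sqrt d + 1) ^ 2 := Nat.lt_succ_sqrt' d
  have h2 : δ < (2 * (Nat.sqrt d + 1)) ^ 2 := by nlinarith
  have h3 : Nat.sqrt δ < 2 * (Nat.sqrt d + 1) := Nat.sqrt_lt'.2 h2
  omega

/-- The number of rounds: `8 δ / (u + 1) ≤ 8 u` for `u = ⌊√δ⌋ + 1`. [folklore] -/
theorem rounds_le (δ : ℕ) : 8 * δ / (Nat.sqrt δ + 1 + 1) ≤ 8 * (Nat.sqrt δ + 1) := by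
  have h1 : δ < (Nat.sqrt δ + 1) ^ 2 := Nat.lt_succ_sqrt' δ
  have h2 : 8 * δ ≤ (Nat.sqrt δ + 1 + 1) * (8 * (Nat.sqrt δ + 1)) := by nlinarith
  exact Nat.div_le_of_le_mul h2

/-- The exponent bookkeeping: one exponent `E` dominating `δ + 1`, `s`, `u + 1` and `δ + u`, where
`δ = d + r ≤ 2d`, `u = ⌊√δ⌋ + 1`, given `d ≤ B^{e₁}` and `s ≤ B^{e₂}`. [folklore] -/
theorem prop321_exponent {B e₁ e₂ d r s : ℕ} (hB : 2 ≤ B) (hd : d ≤ B ^ e₁) (hr : r ≤ d) (hs : s ≤ B ^ e₂) :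
    d + r + 1 ≤ B ^ (e₁ + e₂ + 6) ∧ s ≤ B ^ (e₁ + e₂ + 6) ∧
      Nat.sqrt (d + r) + 1 + 1 ≤ B ^ (e₁ + e₂ + 6) ∧
      d + r + (Nat.sqrt (d + r) + 1) ≤ B ^ (e₁ + e₂ + 6) := by
  have h1e : 1 ≤ B ^ e₁ := Nat.one_le_pow _ _ (by omega)
  have hsq : Nat.sqrt (d + r) ≤ d + r := Nat.sqrt_le_self _
  refine ⟨?_, ?_, ?_, ?_⟩
  · calc d + r + 1 ≤ 3 * B ^ e₁ := by omega
      _ ≤ B ^ (e₁ + 3) := mul_pow_le_pow_add hB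
      _ ≤ B ^ (e₁ + e₂ + 6) := Nat.pow_le_pow_right (by omega) (by omega)
  · exact hs.trans (Nat.pow_le_pow_right (by omega) (by omega))
  · calc Nat.sqrt (d + r) + 1 + 1 ≤ 2 * d + 2 := by omega
      _ ≤ 4 * B ^ e₁ := by omega
      _ ≤ B ^ (e₁ + 4) := mul_pow_le_pow_add hB
      _ ≤ B ^ (e₁ + e₂ + 6) := Nat.pow_le_pow_right (by omega) (by omega)
  · calc d + r + (Nat.sqrt (d + r) + 1) ≤ 4 * d + 1 := by omega
      _ ≤ 5 * B ^ e₁ := by omega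
      _ ≤ B ^ (e₁ + 5) := mul_pow_le_pow_add hB
      _ ≤ B ^ (e₁ + e₂ + 6) := Nat.pow_le_pow_right (by omega) (by omega)

/-- The constant of Prop. 3.21 in terms of the exponent `E`. [folklore] -/
def prop321Const (E : ℕ) : ℕ := 100 * E + 65

/-- Bound on the number of products `k`. [folklore] -/
theorem prop321_kBound {B E D R δ s : ℕ} (hB : 2 ≤ B) (hD : 1 ≤ D) (hδ1 : δ + 1 ≤ B ^ E)
    (hs : s ≤ B ^ E) (hR : R ≤ 16 * D) :
    (δ + 1) * ((4 * s * (δ + 1) ^ 2) * (4 * s * (δ + 1) ^ 2)) ^ R ≤ B ^ (prop321Const E * D) := by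
  have h4 : 4 ≤ B ^ 2 := by rw [pow_two]; exact Nat.mul_le_mul hB hB
  have hone : 4 * s * (δ + 1) ^ 2 ≤ B ^ 2 * B ^ E * (B ^ E) ^ 2 :=
    Nat.mul_le_mul (Nat.mul_le_mul h4 hs) (Nat.pow_le_pow_left hδ1 2)
  have hS2 : (4 * s * (δ + 1) ^ 2) * (4 * s * (δ + 1) ^ 2) ≤ B ^ (6 * E + 4) :=
    calc (4 * s * (δ + 1) ^ 2) * (4 * s * (δ + 1) ^ 2)
        ≤ (B ^ 2 * B ^ E * (B ^ E) ^ 2) * (B ^ 2 * B ^ E * (B ^ E) ^ 2) := Nat.mul_le_mul hone hone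
      _ = B ^ (6 * E + 4) := by ring
  calc (δ + 1) * ((4 * s * (δ + 1) ^ 2) * (4 * s * (δ + 1) ^ 2)) ^ R
      ≤ B ^ E * (B ^ (6 * E + 4)) ^ R := Nat.mul_le_mul hδ1 (Nat.pow_le_pow_left hS2 R)
    _ = B ^ (E + (6 * E + 4) * R) := by rw [← pow_mul, ← pow_add]
    _ ≤ B ^ (prop321Const E * D) := by
        refine Nat.pow_le_pow_right (by omega) ?_
        calc E + (6 * E + 4) * R ≤ E * D + (6 * E + 4) * (16 * D) :=
              Nat.add_le_add (Nat.le_mul_of_pos_right E hD) (Nat.mul_le_mul_left _ hR)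
          _ = (97 * E + 64) * D := by ring
          _ ≤ prop321Const E * D := Nat.mul_le_mul_right D (by unfold prop321Const; omega)

/-- Bound on the number of factors `m`. [folklore] -/
theorem prop321_mBound {E D R : ℕ} (hD : 1 ≤ D) (hR : R ≤ 16 * D) : 1 + 4 * R ≤ prop321Const E * D := by
  unfold prop321Const; nlinarith

/-- Bound on the sparsity `t`. [folklore] -/
theorem prop321_tBound {B E D u δ : ℕ} (hB : 2 ≤ B) (hD : 1 ≤ D) (hu1 : u + 1 ≤ B ^ E)
    (hδu : δ + u ≤ B ^ E) (huD : u ≤ 2 * D) : (u + 1) * (δ + u) ^ u ≤ B ^ (prop321Const E * D) :=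
  calc (u + 1) * (δ + u) ^ u ≤ B ^ E * (B ^ E) ^ u := Nat.mul_le_mul hu1 (Nat.pow_le_pow_left hδu u)
    _ = B ^ (E * (u + 1)) := by rw [← pow_mul, ← pow_add]; ring_nf
    _ ≤ B ^ (prop321Const E * D) := by
        refine Nat.pow_le_pow_right (by omega) ?_
        calc E * (u + 1) ≤ E * (3 * D) := Nat.mul_le_mul_left E (by omega)
          _ = (3 * E) * D := by ring
          _ ≤ prop321Const E * D := Nat.mul_le_mul_right D (by unfold prop321Const; omega)

/-- `1 ≤ C · D` for the constant `C` and `D ≥ 1`. [folklore] -/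
theorem one_le_prop321Const_mul {E D : ℕ} (hD : 1 ≤ D) : 1 ≤ prop321Const E * D := by
  unfold prop321Const; nlinarith

/-! ### Proposition 3.21 from Proposition 3.17 -/

open Polynomial in
/-- **Tavenas' Proposition 3.21 (case `c = 1`, over `ℚ`, `τ`-hypothesis) from Proposition 3.17**,
following the printed proof (thesis p. 47): Prop. 3.17 gives `f_n = h_n(X^{2^j}; 2^{2^i})` with
`h_n` a multilinear projection of `PER_{q(n)}` in `d + r = O(d)` variables, hence with circuits of
size `n^{O(1)}` when `τ(PER_n) = n^{O(1)}` (projections are free; a constant-free circuit over `ℤ`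
is a circuit over `ℚ`); the depth-four reduction (Thm. 2.16, here the tree's
`DepthReduction.SLP.exists_sum_prod` with `t = ⌊√δ⌋ + 1`) writes `h_n` as
`∑_{i ≤ n^{O(√d)}} ∏_{j ≤ O(√d)} p_{ij}` with `deg p_{ij} = O(√d)`, so that each `p_{ij}` — and
its image under the monomial substitution (3.1) — is `n^{O(√d)}`-sparse. [cite: Tavenas2014, Prop. 3.21] -/
theorem Tavenas2014_prop_3_21_of_prop_3_17 (h317 : Tavenas2014_prop_3_17) : Tavenas2014_prop_3_21 := by
  classical
  intro hτ f d r hd hrd hdef hdeg hcoeff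
  have hr : IsPBounded r := hd.mono hrd
  obtain ⟨q, hq, H⟩ := h317 f d r hd hr hdef hdeg hcoeff
  -- polynomial bounds as powers of `B = n + 2`
  obtain ⟨e₁, he₁⟩ := hd.exists_le_pow
  obtain ⟨e₂, he₂⟩ := (IsPBounded.comp_holds hτ hq).exists_le_pow
  refine ⟨prop321Const (e₁ + e₂ + 6), fun n => ?_⟩
  obtain ⟨h, hproj, hml, hsub⟩ := H n
  have hB2 : 2 ≤ n + 2 := by omega
  have hD1 : 1 ≤ Nat.sqrt (d n) + 1 := Nat.succ_pos _
  have hu1 : 1 ≤ Nat.sqrt (d n + r n) + 1 := Nat.succ_pos _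
  have hδd : d n + r n ≤ 2 * d n := by have := hrd n; omega
  have huD : Nat.sqrt (d n + r n) + 1 ≤ 2 * (Nat.sqrt (d n) + 1) := sqrt_add_one_le hδd
  have hRle : 8 * (d n + r n) / (Nat.sqrt (d n + r n) + 1 + 1) ≤ 16 * (Nat.sqrt (d n) + 1) :=
    (rounds_le _).trans (by omega)
  -- size of a minimal circuit for `h` (an opaque name `s`, so that no tactic unfolds `complexity`)
  obtain ⟨s, hs⟩ : ∃ s : ℕ, complexity h = s := ⟨_, rfl⟩
  have hsle : s ≤ (n + 2) ^ e₂ :=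
    calc s = complexity h := hs.symm
      _ ≤ complexity (perPoly (Fin (q n)) ℚ) := IsProjection.complexity_le_holds hproj
      _ = complexity ((perPoly (Fin (q n)) ℤ).map (Int.castRingHom ℚ)) := by rw [map_perPoly]
      _ ≤ constantFreeComplexity (perPoly (Fin (q n)) ℤ) :=
          complexity_map_le_constantFreeComplexity _ _
      _ ≤ (n + 2) ^ e₂ := he₂ n
  -- the exponent
  obtain ⟨hδ1, hsE, hu1', hδu⟩ := prop321_exponent hB2 (he₁ n) (hrd n) hsle
  -- the sparsity bound of a polynomial of degree `≤ u` in `δ` variables under the substitution (3.1)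
  have hsparse : ∀ p : MvPolynomial (Fin (d n) ⊕ Fin (r n)) ℚ, p.totalDegree ≤ Nat.sqrt (d n + r n) + 1 →
      (MvPolynomial.aeval (kpSubst (d n) (r n)) p).support.card ≤
        (n + 2) ^ (prop321Const (e₁ + e₂ + 6) * (Nat.sqrt (d n) + 1)) := by
    intro p hp
    calc (MvPolynomial.aeval (kpSubst (d n) (r n)) p).support.card ≤ p.support.card :=
          card_support_aeval_le_of_isTerm (isTerm_kpSubst _ _) p
      _ ≤ (Nat.sqrt (d n + r n) + 1 + 1) *
            (Fintype.card (Fin (d n) ⊕ Fin (r n)) + (Nat.sqrt (d n + r n) + 1)) ^ (Nat.sqrt (d n + r n) + 1) :=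
          DepthReduction.card_le_of_degree_le _ hu1 fun m hm => (le_totalDegree hm).trans hp
      _ = (Nat.sqrt (d n + r n) + 1 + 1) *
            (d n + r n + (Nat.sqrt (d n + r n) + 1)) ^ (Nat.sqrt (d n + r n) + 1) := by
          rw [Fintype.card_sum, Fintype.card_fin, Fintype.card_fin]
      _ ≤ (n + 2) ^ (prop321Const (e₁ + e₂ + 6) * (Nat.sqrt (d n) + 1)) := prop321_tBound hB2 hD1 hu1' hδu huD
  have hfmap : (f n).map (Int.castRingHom ℚ) = MvPolynomial.aeval (kpSubst (d n) (r n)) h := hsub.symm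
  -- a minimal circuit for `h` and its straight-line program
  obtain ⟨P, hP1, hP2, hP3⟩ := exists_computes_size_eq_complexity h
  obtain ⟨S, hSlen, hcases⟩ := DepthReduction.exists_slp P hP1
  rw [show P.eval = h from hP2] at hcases
  rw [hs] at hP3
  rcases hcases with ⟨i, hi, hval⟩ | htriv
  · -- main case: `h` is a value of the straight-line program
    have hdegh : (S.val i).totalDegree ≤ d n + r n := by
      rw [← hval]
      have := totalDegree_le_card_of_multilinear hml
      rwa [Fintype.card_sum, Fintype.card_fin, Fintype.card_fin] at this
    obtain ⟨L, hLsum, hLlen, hLT⟩ := S.exists_sum_prod (d n + r n) (t := Nat.sqrt (d n + r n) + 1) hu1 hi hdegh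
    rw [hSlen, hP3] at hLlen
    refine ⟨L.length, 1 + 4 * (8 * (d n + r n) / (Nat.sqrt (d n + r n) + 1 + 1)),
      (n + 2) ^ (prop321Const (e₁ + e₂ + 6) * (Nat.sqrt (d n) + 1)),
      fun i j => MvPolynomial.aeval (kpSubst (d n) (r n)) ((L[i.val]).getD j.val 1),
      hLlen.trans (prop321_kBound hB2 hD1 hδ1 hsE hRle), prop321_mBound hD1 hRle, le_rfl, ?_, ?_⟩
    · -- sparsity of the factors
      intro i j
      apply hsparse
      rcases DepthReduction.getD_one_mem_or (L[i.val]) j.val with hmem | hone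
      · exact (hLT _ (List.getElem_mem _)).2 _ hmem
      · rw [hone, totalDegree_one]; exact Nat.zero_le _
    · -- the identity `∑ ∏ g i j = f_n`
      rw [hfmap, hval, ← hLsum]
      have hprod : ∀ i : Fin L.length,
          ∏ j : Fin (1 + 4 * (8 * (d n + r n) / (Nat.sqrt (d n + r n) + 1 + 1))),
              MvPolynomial.aeval (kpSubst (d n) (r n)) ((L[i.val]).getD j.val 1) =
            MvPolynomial.aeval (kpSubst (d n) (r n)) (L[i.val]).prod := fun i => by
        rw [← map_prod, DepthReduction.prod_getD_one _ _ (hLT _ (List.getElem_mem _)).1]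
      simp only [hprod]
      rw [map_list_sum, List.map_map]
      exact Fin.sum_univ_fun_getElem L (fun l => MvPolynomial.aeval (kpSubst (d n) (r n)) l.prod)
  · -- degenerate case: `h` is a variable or a constant, a single term
    have hterm : IsTerm (MvPolynomial.aeval (kpSubst (d n) (r n)) h) := by
      rcases htriv with ⟨j, hj⟩ | ⟨c, hc⟩
      · rw [hj, MvPolynomial.aeval_X]; exact isTerm_kpSubst _ _ j
      · rw [hc, MvPolynomial.aeval_C, Polynomial.algebraMap_eq]; exact isTerm_C c
    have h1 : 1 ≤ (n + 2) ^ (prop321Const (e₁ + e₂ + 6) * (Nat.sqrt (d n) + 1)) :=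
      Nat.one_le_pow _ _ (by omega)
    refine ⟨1, 1, 1, fun _ _ => MvPolynomial.aeval (kpSubst (d n) (r n)) h, h1,
      one_le_prop321Const_mul hD1, h1, fun _ _ => hterm.card_support_le, ?_⟩
    rw [hfmap]; simp

end Literature.Computability.AlgebraicComplexity
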